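import Mathlib

/-!
# Seed checker C5–C8, v32 — the two SYMBOL LAWS (N1), (CAP) at the two-term door and the SYMBOL-CAPACITY NO-GO

Cell `pub-hsemireg`, seat `hsemireg-c5c8-1`, generation 32.  Companion memo:
`Cruxes/BlochSeedDiscOne/SEED-CHECKER-C5C8-c5c8-1-g32.md`; script `g32/code/apexstarve.py` (SCREEN 3, a json
functional reusing the g30 cohomology oracle `g30/code/seedcheck_json.py`); data `g32/out/apexstarve-toyPresB.json`,
`g32/out/apexstarve-toyPres.json`.

HONEST FRAMING.  Nothing in this file is proved toward `HC`, `HC_CM`, `HC_AV`, ladder rung №4, `stmt-26512`,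
`stmt-18881` (`BlochSeedDiscOne`) or `H2`.  The seat produces evidence and typed files, not rungs; the registered stub
`stub_rung_pad4_seedAt` is neither restated nor weakened.  This module is a Mathlib-only record (the crux satellites
v5–v31 and `C4LetterSymbol` are unbuilt on the farm snapshot, so nothing newer than Mathlib is imported) of:

* §1  the two ALGEBRAIC CORES of the symbol laws for a two-term locally free resolution `R = [𝓟 → 𝓝]` of a sheaf
  `𝓔 = coker φ`, written for block matrices over a commutative ring (index order: the degree `−1` summand `P` first):
  (N1-core) a cochain of block degree `≥ 1` (only a `Hom(P,N)` block) stays of block degree `≥ 1` under left/right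
  multiplication by cochains of block degree `≥ 0` (no `Hom(N,P)` block) and under powers of them, and has ZERO trace
  and ZERO supertrace (`f0_pow_mul_f1`, `trace_f0_pow_mul_f1`, `strace_f0_pow_mul_f1`) — this is why every component
  `σ_p(y) = tr(At(𝓔)^p ∘ y)/p!` of the Buchweitz–Flenner semiregularity map kills `F¹Ext²(𝓔,𝓔)` (the Atiyah class of
  `R` has block degrees `0` (curvatures) and `+1` (`∇φ`) only);
  (CAP-core) against powers of a CELL-SCALAR diagonal (`At₀ = ⊕_Z x_Z · id` on the copies of each line-bundle cell `Z`,
  Pic⁰-twists having zero Atiyah class) the trace of a degree-`0` component `Y` depends on `Y` only through its vector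
  of per-cell partial traces `cellSymbol` (`symbol_factor`, `traces_eq_of_cellSymbol_eq`) — so `σ|F⁰` factors through
  `⊕_{cells} H^{0,2}(X)`, a space of dimension `h^{0,2} · #cells`.
* §2  the abstract door with both laws (`TwoSymbolLaws`: `σ(F¹) = 0` and `σ|F⁰ = M ∘ s` through a symbol space
  `Sym`): injectivity of `σ` forces `F¹ = ⊥` and `finrank F⁰ ≤ finrank Sym` (`F1_eq_bot`, `finrank_F0_le`).  The sibling
  structure `HSemireg.C4LetterSymbol.LetterSymbolDatum` (hsemireg-c4-1 g22, the `δc₄` door of monads) types the `F⁰`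
  half for a different door; here the sheaf door needs the `F¹` layer as well, hence a separate two-step structure.
* §3  the CENSUS ARITHMETIC.  With the `E₁` data of the toy presentation `toyPresB`
  (`U2-TORUS-TOY-presentation-h4-variantB-top40-bot8.json`, sha16 `5768bd6a0f7ae530`; all 4 356 ordered cell pairs
  re-derived by `apexstarve.py` from the oracle, shape hypotheses (S1)–(S5) of the memo hold with 0 violations):
  `e₁(1,1) = 4Λ`, `e₁(1,2) = 6Λ` (`Λ` = number of cohomologically live (P-letter, top-apex copy) pairs),
  `e₁(−1,2) = 0`, `e₁(0,2) ≥ 28(64 + ΣB² + S)` (`S = Σ_k c_k² ≥ 40` over the Pic⁰-twist classes of the 40 top copies,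
  `ΣB² ≥ 8` for the 8 bottom copies), and `rk d₁^{0,1} ≤ 256 + 8S` (only P-letter scalars and top-class blocks have
  non-zero `d₁`-image), the two laws read `(N1) 4Λ ≤ 256 + 8S` and `(CAP) 28(72 + S) − 6Λ ≤ 28 · 66 = 1848`, and
  `toyPresB_symbolCapacity_noGo` derives `False` by `omega` — for EVERY realisation pattern (all Pic⁰ twists of all
  120 cells, thinned or not, every map `φ`), at EVERY door (vector bundle or coherent) and EVERY window budget.  The
  parametric form `symbolCapacity_noGo` isolates the json-level criterion; `toyPres_symbolCapacity_noGo` is the same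
  for the negative control; `singleScale_noGo_*` record that for single-scale U2 UP presentations whose letters see only
  the apex, Hall (`p ≤ a`) already triggers the criterion from `p ≥ 8` letters on.
* §4  an INDEPENDENT kill at the vector-bundle door (APEX STARVATION, no (CAP) law used): `C5` forces every P-letter
  to use `≥ g − κ + 1 = 5` distinct top twist classes (at most four ample divisors on the abelian 4-fold `B_s` always
  meet), and (N1) with the finer capacity `Σ_k c_k · min(g·d_k, κ·m_k)` gives `κ Σ_k m_k ≤ g(a + p)`
  (`apexStarvation`, a `Finset` inequality proved termwise); for toyPresB `4·5·32 = 640 > 8·(40 + 32) = 576`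
  (`toyPresB_apexStarved`).
* §5  consistency digits: the g31 mod-`p` exact values on the fully-live family violate both laws
  (`fullyLive_balanced_violates_N1/_CAP`).

Not in Lean (by design, as in v30/v31): the cohomology oracle (Mumford's index theorem and the degenerate-bundle rule,
Lange–Birkenhake CAV), the identification of the BF semiregularity map with `tr(At^p ∘ ·)` on the resolution, and the
Dolbeault bookkeeping of the column filtration — these are the pen proof of the memo (§1) and the exact python census.

Hygiene: `import Mathlib` only; every proof closed; no new type-class instances, no notation/macro, no axioms, no
`sorry`, no unsafe options (the only `set_option` silences the duplicated-namespace linter of the summit path).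
-/

set_option linter.dupNamespace false

namespace Summit.HodgeConjecture.HodgeConjecture.Cruxes.BlochSeedDiscOne.SeedCheckerSymbolCapacity

open Finset Matrix

/-! ## §1  Algebraic cores of the two symbol laws -/

section BlockDegree

variable {R : Type*} [CommRing R]
variable {m n : Type*} [Fintype m] [Fintype n] [DecidableEq m] [DecidableEq n]

/-!
Index convention.  An endomorphism cochain of `R = [P → N]` is a block matrix `fromBlocks A B C D` acting on column
vectors `(p; n)`: `A = End P`, `D = End N` (block degree `0`), `C = Hom(P,N)` (block degree `+1`),
`B = Hom(N,P)` (block degree `−1`).  `F⁰` = `B = 0`; `F¹` = only `C`.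
-/

/-- `F⁰ · F¹ ⊆ F¹`: a degree-`≥ 0` cochain times a degree-`≥ 1` cochain has only a `Hom(P,N)` block. -/
theorem f0_mul_f1 (A : Matrix m m R) (C : Matrix n m R) (D : Matrix n n R) (Y : Matrix n m R) :
    fromBlocks A 0 C D * fromBlocks 0 0 Y 0 = fromBlocks 0 0 (D * Y) (0 : Matrix n n R) := by
  simp [fromBlocks_multiply]

/-- `F¹ · F⁰ ⊆ F¹`. -/
theorem f1_mul_f0 (A : Matrix m m R) (C : Matrix n m R) (D : Matrix n n R) (Y : Matrix n m R) :
    fromBlocks 0 0 Y 0 * fromBlocks A 0 C D = fromBlocks 0 0 (Y * A) (0 : Matrix n n R) := by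
  simp [fromBlocks_multiply]

/-- Powers of an `F⁰` cochain times an `F¹` cochain stay in `F¹` (the shape of `At(R)^p ∘ y` for `y ∈ F¹`). -/
theorem f0_pow_mul_f1 (A : Matrix m m R) (C : Matrix n m R) (D : Matrix n n R) (Y : Matrix n m R) (k : ℕ) :
    (fromBlocks A 0 C D) ^ k * fromBlocks 0 0 Y 0 = fromBlocks 0 0 (D ^ k * Y) (0 : Matrix n n R) := by
  induction k with
  | zero => simp
  | succ k ih => rw [pow_succ', mul_assoc, ih, f0_mul_f1, ← Matrix.mul_assoc, ← pow_succ']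

omit [DecidableEq m] [DecidableEq n] in
/-- The trace of a block matrix is the sum of the traces of its diagonal blocks (folklore; restated, the Mathlib
snapshot has no `Matrix.trace_fromBlocks`). -/
theorem trace_fromBlocks_eq (A : Matrix m m R) (B : Matrix m n R) (C : Matrix n m R) (D : Matrix n n R) :
    (fromBlocks A B C D).trace = A.trace + D.trace := by
  simp [Matrix.trace, Fintype.sum_sum_type]

omit [DecidableEq m] [DecidableEq n] in
/-- An `F¹` cochain has zero trace … -/
theorem trace_f1 (Y : Matrix n m R) : (fromBlocks (0 : Matrix m m R) 0 Y (0 : Matrix n n R)).trace = 0 := by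
  rw [trace_fromBlocks_eq, trace_zero, trace_zero, add_zero]

/-- The supertrace of a block cochain: `+ tr` on the degree-`0` summand `N`, `− tr` on the degree-`−1` summand `P`. -/
def strace (M : Matrix (m ⊕ n) (m ⊕ n) R) : R := M.toBlocks₂₂.trace - M.toBlocks₁₁.trace

omit [DecidableEq m] [DecidableEq n] in
theorem strace_fromBlocks (A : Matrix m m R) (B : Matrix m n R) (C : Matrix n m R) (D : Matrix n n R) :
    strace (fromBlocks A B C D) = D.trace - A.trace := by
  simp [strace]

omit [DecidableEq m] [DecidableEq n] in
/-- … and zero supertrace. -/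
theorem strace_f1 (Y : Matrix n m R) : strace (fromBlocks (0 : Matrix m m R) 0 Y (0 : Matrix n n R)) = 0 := by
  simp [strace]

/-- (N1-core)  `tr(T^k · Y) = 0` for `T ∈ F⁰`, `Y ∈ F¹`: every component `σ_k` of the semiregularity map vanishes on
block-degree-`≥ 1` classes. -/
theorem trace_f0_pow_mul_f1 (A : Matrix m m R) (C : Matrix n m R) (D : Matrix n n R) (Y : Matrix n m R) (k : ℕ) :
    ((fromBlocks A 0 C D) ^ k * fromBlocks 0 0 Y 0).trace = 0 := by
  rw [f0_pow_mul_f1, trace_f1]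

/-- (N1-core, graded version). -/
theorem strace_f0_pow_mul_f1 (A : Matrix m m R) (C : Matrix n m R) (D : Matrix n n R) (Y : Matrix n m R) (k : ℕ) :
    strace ((fromBlocks A 0 C D) ^ k * fromBlocks 0 0 Y 0) = 0 := by
  rw [f0_pow_mul_f1, strace_f1]

end BlockDegree

section SymbolCore

variable {R : Type*} [CommRing R]
variable {ι K : Type*} [Fintype ι] [DecidableEq ι] [Fintype K] [DecidableEq K]

/-- The CLASS SYMBOL of a degree-`0` component `Y` (indexed by copies `i : ι` of cells `cls i : K`): the vector of
per-cell partial traces `Z ↦ Σ_{i : cls i = Z} Y i i`. -/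
def cellSymbol (cls : ι → K) (Y : Matrix ι ι R) : K → R :=
  fun Z => ∑ i ∈ univ.filter (fun i => cls i = Z), Y i i

theorem trace_diagonal_pow_mul (d : ι → R) (Y : Matrix ι ι R) (k : ℕ) :
    ((diagonal d) ^ k * Y).trace = ∑ i, d i ^ k * Y i i := by
  rw [diagonal_pow]
  simp [Matrix.trace, diagonal_mul, Pi.pow_apply]

/-- (CAP-core)  Against powers of a cell-scalar diagonal `At₀ = diag(x (cls i))` the trace of `At₀^k · Y` is a
function of the class symbol of `Y` alone: `Σ_Z x_Z^k · cellSymbol Y Z`. -/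
theorem symbol_factor (cls : ι → K) (x : K → R) (Y : Matrix ι ι R) (k : ℕ) :
    ((diagonal (fun i => x (cls i))) ^ k * Y).trace = ∑ Z, x Z ^ k * cellSymbol cls Y Z := by
  rw [trace_diagonal_pow_mul]
  rw [← sum_fiberwise_of_maps_to (s := univ) (t := univ) (g := cls) (fun i _ => mem_univ (cls i))]
  refine sum_congr rfl (fun Z _ => ?_)
  rw [cellSymbol, mul_sum]
  refine sum_congr rfl (fun i hi => ?_)
  rw [(mem_filter.mp hi).2]

/-- Hence two degree-`0` components with the same class symbol have the same traces against every power: the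
restriction of every `σ_k` to `F⁰/F¹` factors through `cellSymbol`, whose target has `#K` slots. -/
theorem traces_eq_of_cellSymbol_eq (cls : ι → K) (x : K → R) (Y Y' : Matrix ι ι R)
    (h : cellSymbol cls Y = cellSymbol cls Y') (k : ℕ) :
    ((diagonal (fun i => x (cls i))) ^ k * Y).trace = ((diagonal (fun i => x (cls i))) ^ k * Y').trace := by
  rw [symbol_factor, symbol_factor, h]

omit [DecidableEq ι] [Fintype K] in
/-- The symbol is linear (so "factors through the symbol" bounds ranks by the number of slots). -/
theorem cellSymbol_add (cls : ι → K) (Y Y' : Matrix ι ι R) :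
    cellSymbol cls (Y + Y') = cellSymbol cls Y + cellSymbol cls Y' := by
  funext Z
  simp [cellSymbol, sum_add_distrib]

omit [DecidableEq ι] [Fintype K] in
theorem cellSymbol_smul (cls : ι → K) (r : R) (Y : Matrix ι ι R) :
    cellSymbol cls (r • Y) = r • cellSymbol cls Y := by
  funext Z
  simp [cellSymbol, mul_sum]

end SymbolCore

/-! ## §2  The abstract two-term door with both symbol laws -/

section Door

variable {F V S T : Type*} [Field F] [AddCommGroup V] [Module F V] [AddCommGroup S] [Module F S]
  [AddCommGroup T] [Module F T]

/-- The two symbol laws at the two-term (sheaf) door, as a hypothesis structure on `V = Ext²_X(𝓔,𝓔)`: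
`F1 ≤ F0 ≤ V` are the block-degree filtration steps (`F1 = E_∞^{1,1}`, `F0/F1 = E_∞^{0,2}`), `σ : V → T` is the
(windowed) semiregularity map, `s : F0 → S` a symbol map through the symbol space `S` (`dim S ≤ h^{0,2} · #cells`)
and `M : S → T` the alphabet's symbol matrix.  LAW (N1): `σ` kills `F1`.  LAW (CAP): `σ|F0 = M ∘ s`. -/
structure TwoSymbolLaws (F V S T : Type*) [Field F] [AddCommGroup V] [Module F V] [AddCommGroup S] [Module F S]
    [AddCommGroup T] [Module F T] where
  /-- the semiregularity map (any window of components) -/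
  σ : V →ₗ[F] T
  /-- block degree `≥ 0` classes -/
  F0 : Submodule F V
  /-- block degree `≥ 1` classes -/
  F1 : Submodule F V
  le : F1 ≤ F0
  /-- a class-symbol map on `F0` -/
  s : F0 →ₗ[F] S
  /-- the symbol matrix -/
  M : S →ₗ[F] T
  /-- LAW (N1): `σ(F¹) = 0` -/
  lawN1 : ∀ y ∈ F1, σ y = 0
  /-- LAW (CAP): `σ|F⁰` factors through the symbol -/
  lawCAP : ∀ y : F0, σ (y : V) = M (s y)

namespace TwoSymbolLaws

variable (L : TwoSymbolLaws F V S T)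

/-- (N1) If `σ` is injective, there are no block-degree-`≥ 1` classes: `E_∞^{1,1} = 0`. -/
theorem F1_eq_bot (hinj : Function.Injective L.σ) : L.F1 = ⊥ := by
  rw [Submodule.eq_bot_iff]
  intro y hy
  exact hinj (by rw [L.lawN1 y hy, map_zero])

/-- (CAP) If `σ` is injective, the symbol map is injective on `F0` … -/
theorem s_injective (hinj : Function.Injective L.σ) : Function.Injective L.s := by
  intro y y' h
  have : L.σ (y : V) = L.σ (y' : V) := by rw [L.lawCAP, L.lawCAP, h]
  exact Subtype.ext (hinj this)

/-- … so `dim F⁰Ext² ≤ dim S` (`= h^{0,2} · #cells` for the cell symbol). -/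
theorem finrank_F0_le [FiniteDimensional F S] (hinj : Function.Injective L.σ) :
    Module.finrank F L.F0 ≤ Module.finrank F S :=
  LinearMap.finrank_le_finrank_of_injective (L.s_injective hinj)

/-- Both laws together: injectivity needs `E_∞^{1,1} = 0` AND `e_∞^{0,2} + e_∞^{1,1} = dim F⁰ ≤ dim S`. -/
theorem necessary [FiniteDimensional F S] (hinj : Function.Injective L.σ) :
    L.F1 = ⊥ ∧ Module.finrank F L.F0 ≤ Module.finrank F S :=
  ⟨L.F1_eq_bot hinj, L.finrank_F0_le hinj⟩

/-- Contrapositive used by the checker: a symbol space smaller than `F⁰` refutes semiregularity. -/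
theorem not_injective_of_finrank_lt [FiniteDimensional F S] (h : Module.finrank F S < Module.finrank F L.F0) :
    ¬ Function.Injective L.σ :=
  fun hinj => (Nat.lt_irrefl _) (lt_of_lt_of_le h (L.finrank_F0_le hinj))

end TwoSymbolLaws

end Door

/-! ## §3  Census arithmetic: the SYMBOL-CAPACITY NO-GO

Dictionary (memo §2–§3; `apexstarve.py` fields): `Λ` = number of cohomologically live (P-letter, top copy) pairs,
`S = Σ_k c_k²` over the Pic⁰-twist classes of the `a` top-apex copies (`a ≤ S`), `Bsq = Σ_i b_i²` over the twist classes
of the `bm` bottom copies (`bm ≤ Bsq`), `e02 = e₁(0,2)`, `r02 = rk d₁^{0,2}`, `r01 = rk d₁^{0,1}`; the oracle constants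
`h02 = h^{0,2}(X) = 28`, `h01 = 8`, `h1 = h¹` and `h2 = h²` of a live letter→apex Hom (`4`, `6`), `K` = number of cells.
-/

section Census

/-- Parametric SYMBOL-CAPACITY NO-GO.  Hypotheses, in order: the `E₁^{0,2}` floor (scalars of the `p + n` letters and
the class blocks), `rk d₁^{0,2} ≤ e₁(1,2) = h2·Λ`, LAW (CAP) (`e_∞^{0,2} = e02 − r02 ≤ h02·K`), LAW (N1) with the crude
source capacity (`h1·Λ = e₁(1,1) = rk d₁^{0,1} ≤ h01·p + h01·S`), and the json-level CRITERION
`h01·h2·(p+a) + h1·h02·K < h1·h02·(p+n+bm+a)` together with the slope condition `h01·h2 ≤ h1·h02`. -/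
theorem symbolCapacity_noGo {h02 h01 h1 h2 p n bm a K Λ S Bsq e02 r02 : ℕ}
    (hS : a ≤ S) (hB : bm ≤ Bsq)
    (he02 : h02 * (p + n + Bsq + S) ≤ e02)
    (hr02 : r02 ≤ h2 * Λ)
    (hCAP : e02 ≤ h02 * K + r02)
    (hN1 : h1 * Λ ≤ h01 * p + h01 * S)
    (hcrit : h01 * h2 * (p + a) + h1 * h02 * K < h1 * h02 * (p + n + bm + a))
    (hslope : h01 * h2 ≤ h1 * h02) : False := by
  obtain ⟨u, rfl⟩ : ∃ u, S = a + u := ⟨S - a, by omega⟩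
  obtain ⟨v, rfl⟩ : ∃ v, Bsq = bm + v := ⟨Bsq - bm, by omega⟩
  -- chain (CAP): h02 (p+n+bm+v+a+u) ≤ h02 K + h2 Λ
  have h1' : h02 * (p + n + (bm + v) + (a + u)) ≤ h02 * K + h2 * Λ := le_trans he02 (le_trans hCAP (by omega))
  have hA : h1 * (h02 * (p + n + (bm + v) + (a + u))) ≤ h1 * (h02 * K + h2 * Λ) := Nat.mul_le_mul_left h1 h1'
  have hB' : h2 * (h1 * Λ) ≤ h2 * (h01 * p + h01 * (a + u)) := Nat.mul_le_mul_left h2 hN1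
  have hsl : h01 * h2 * u ≤ h1 * h02 * u := Nat.mul_le_mul_right u hslope
  linarith [hA, hB', hsl, hcrit, Nat.zero_le (h1 * h02 * v)]

/-- toyPresB (`5768bd6a0f7ae530`): `p = n = 32` letters, `a = 40` top copies, `bm = 8` bottom copies, `K = 66` cells,
`(h02,h01,h1,h2) = (28,8,4,6)`.  The two laws and the census floor are jointly infeasible for every `Λ`, `S ≥ 40`,
`Bsq ≥ 8`: NO realisation pattern of toyPresB (any Pic⁰ twists, any `φ`, bundle or coherent door, any window) is
semiregular. -/
theorem toyPresB_symbolCapacity_noGo (Λ S Bsq e02 r02 r01 : ℕ)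
    (hS : 40 ≤ S) (hB : 8 ≤ Bsq)
    (he02 : 28 * (64 + Bsq + S) ≤ e02)
    (hr02 : r02 ≤ 6 * Λ)
    (hCAP : e02 ≤ 1848 + r02)
    (hr01 : r01 ≤ 256 + 8 * S)
    (hN1 : 4 * Λ ≤ r01) : False := by
  omega

/-- The json-level criterion of `symbolCapacity_noGo` evaluated on toyPresB: `48·72 + 112·66 = 10848 < 112·112 = 12544`. -/
theorem toyPresB_criterion : 8 * 6 * (32 + 40) + 4 * 28 * 66 < 4 * 28 * (32 + 32 + 8 + 40) := by norm_num

/-- The same no-go via the parametric theorem (cross-check of the instance against the schema). -/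
theorem toyPresB_symbolCapacity_noGo' (Λ S Bsq e02 r02 : ℕ) (hS : 40 ≤ S) (hB : 8 ≤ Bsq)
    (he02 : 28 * (32 + 32 + Bsq + S) ≤ e02) (hr02 : r02 ≤ 6 * Λ) (hCAP : e02 ≤ 28 * 66 + r02)
    (hN1 : 4 * Λ ≤ 8 * 32 + 8 * S) : False :=
  symbolCapacity_noGo (h02 := 28) (h01 := 8) (h1 := 4) (h2 := 6) (p := 32) (n := 32) (bm := 8) (a := 40) (K := 66)
    hS hB he02 hr02 hCAP hN1 (by norm_num) (by norm_num)

/-- toyPres (`d66927515841dbdf`, the negative control; no bottom apex, `a = 33`, `K = 65`): dead by the same count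
(it is also Chern–Hall-dead, v30). -/
theorem toyPres_symbolCapacity_noGo (Λ S e02 r02 r01 : ℕ)
    (hS : 33 ≤ S)
    (he02 : 28 * (64 + S) ≤ e02)
    (hr02 : r02 ≤ 6 * Λ)
    (hCAP : e02 ≤ 28 * 65 + r02)
    (hr01 : r01 ≤ 256 + 8 * S)
    (hN1 : 4 * Λ ≤ r01) : False := by
  omega

/-- What the laws leave: with (N1) alone (no (CAP)) the live-pair count is capped, `Λ ≤ 64 + 2S`; with (CAP) alone it
is floored, `6Λ ≥ 168 + 28S` (toyPresB).  Recorded as the two one-sided consequences. -/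
theorem toyPresB_N1_cap (Λ S r01 : ℕ) (hr01 : r01 ≤ 256 + 8 * S) (hN1 : 4 * Λ ≤ r01) : Λ ≤ 64 + 2 * S := by
  omega

theorem toyPresB_CAP_floor (Λ S Bsq e02 r02 : ℕ) (hB : 8 ≤ Bsq) (he02 : 28 * (64 + Bsq + S) ≤ e02)
    (hr02 : r02 ≤ 6 * Λ) (hCAP : e02 ≤ 1848 + r02) : 168 + 28 * S ≤ 6 * Λ := by
  omega

/-- SINGLE-SCALE DESIGN LAW (memo §5).  For a single-scale U2 UP presentation whose P-letters see only the top apex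
(shape (S1)–(S5)), with `p` P-letters, `n` N-letters, `a` top copies, `bm` bottom copies and `K = p + n + e` cells
(`e` scalar cells), the criterion reads `48(p+a) + 112e < 64a + 112bm + 48p`… precisely
`48(p+a) + 112(p+n+e) < 112(p+n+bm+a)`.  Hall for the letters (`p ≤ a`) triggers it from `p ≥ 8` on: -/
theorem singleScale_noGo_noBottom (p n a : ℕ) (hHall : p ≤ a) (hp : 8 ≤ p) :
    8 * 6 * (p + a) + 4 * 28 * (p + n + 1) < 4 * 28 * (p + n + 0 + a) := by
  omega

theorem singleScale_noGo_withBottom (p n a bm : ℕ) (hHall : p ≤ a) (hbm : 1 ≤ bm) (hp : 8 ≤ p) :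
    8 * 6 * (p + a) + 4 * 28 * (p + n + 2) < 4 * 28 * (p + n + bm + a) := by
  omega

end Census

/-! ## §4  APEX STARVATION — an independent kill at the vector-bundle door (no (CAP) law)

Per top twist class `k`: `c k ≥ 1` copies, `ℓ k` letters for which the class is cohomologically live, `m k ≤ ℓ k`
letters actually mapped into it, `d k ≤ c k` (and `≤ m k`) the rank of the coefficient vectors.  (N1) with the finer
capacity: `κ Σ c·ℓ = e₁(1,1) = rk d₁^{0,1} ≤ g·p + Σ_k c_k · min(g·d_k, κ·m_k)`.  `C5` (𝓔 locally free): every letter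
uses `≥ g − κ + 1` distinct classes, so `Σ_k m_k ≥ (g − κ + 1)·p`.
-/

section ApexStarvation

private theorem termwise (g κ c ℓ m d : ℕ) (hc : 1 ≤ c) (hml : m ≤ ℓ) (hdc : d ≤ c) :
    κ * m + c * min (g * d) (κ * m) ≤ g * c + κ * (c * ℓ) := by
  rcases le_total (g * d) (κ * m) with h | h
  · rw [min_eq_left h]
    obtain ⟨c', rfl⟩ : ∃ c', c = c' + 1 := ⟨c - 1, by omega⟩
    have h1 : κ * m ≤ κ * ℓ := Nat.mul_le_mul_left κ hml
    have h2 : c' * (g * d) ≤ c' * (κ * ℓ) := Nat.mul_le_mul_left c' (h.trans h1)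
    have h3 : g * d ≤ g * (c' + 1) := Nat.mul_le_mul_left g hdc
    nlinarith [h1, h2, h3]
  · rw [min_eq_right h]
    have h1 : c * (κ * m) ≤ c * (κ * ℓ) := Nat.mul_le_mul_left c (Nat.mul_le_mul_left κ hml)
    have h2 : g * d ≤ g * c := Nat.mul_le_mul_left g hdc
    nlinarith [h, h1, h2]

/-- APEX STARVATION (capacity form): (N1) with the fine capacity bound forces `κ · Σ_k m_k ≤ g · (Σ_k c_k + p)`. -/
theorem apexStarvation {ι : Type*} (s : Finset ι) (c ℓ m d : ι → ℕ) (g κ p : ℕ)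
    (hc : ∀ k ∈ s, 1 ≤ c k) (hml : ∀ k ∈ s, m k ≤ ℓ k) (hdc : ∀ k ∈ s, d k ≤ c k)
    (hN1 : κ * ∑ k ∈ s, c k * ℓ k ≤ g * p + ∑ k ∈ s, c k * min (g * d k) (κ * m k)) :
    κ * ∑ k ∈ s, m k ≤ g * ∑ k ∈ s, c k + g * p := by
  have hsum : ∑ k ∈ s, (κ * m k + c k * min (g * d k) (κ * m k)) ≤
      ∑ k ∈ s, (g * c k + κ * (c k * ℓ k)) :=
    sum_le_sum (fun k hk => termwise g κ (c k) (ℓ k) (m k) (d k) (hc k hk) (hml k hk) (hdc k hk))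
  rw [sum_add_distrib, sum_add_distrib, ← mul_sum, ← mul_sum, ← mul_sum] at hsum
  omega

/-- With `C5` (`need · p ≤ Σ m`, `need = g − κ + 1` distinct classes per letter): `κ · need · p ≤ g · (a + p)`. -/
theorem apexStarvation_of_C5 {ι : Type*} (s : Finset ι) (c ℓ m d : ι → ℕ) (g κ p need : ℕ)
    (hc : ∀ k ∈ s, 1 ≤ c k) (hml : ∀ k ∈ s, m k ≤ ℓ k) (hdc : ∀ k ∈ s, d k ≤ c k)
    (hN1 : κ * ∑ k ∈ s, c k * ℓ k ≤ g * p + ∑ k ∈ s, c k * min (g * d k) (κ * m k))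
    (hC5 : need * p ≤ ∑ k ∈ s, m k) :
    κ * (need * p) ≤ g * ∑ k ∈ s, c k + g * p :=
  le_trans (Nat.mul_le_mul_left κ hC5) (apexStarvation s c ℓ m d g κ p hc hml hdc hN1)

/-- toyPresB at the bundle door: `g = 8`, `κ = 4`, `need = 5`, `p = 32`, `a = Σ c = 40`: `640 ≤ 576` is false, so
`C5 ∧ (N1)` is infeasible for every pattern — the top apex is STARVED (`a ≥ 48` copies would be needed; `≥ 64` with
the cup-rank-`κ` scalar capacity). -/
theorem toyPresB_apexStarved {ι : Type*} (s : Finset ι) (c ℓ m d : ι → ℕ)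
    (hc : ∀ k ∈ s, 1 ≤ c k) (hml : ∀ k ∈ s, m k ≤ ℓ k) (hdc : ∀ k ∈ s, d k ≤ c k)
    (ha : ∑ k ∈ s, c k = 40)
    (hN1 : 4 * ∑ k ∈ s, c k * ℓ k ≤ 8 * 32 + ∑ k ∈ s, c k * min (8 * d k) (4 * m k))
    (hC5 : 5 * 32 ≤ ∑ k ∈ s, m k) : False := by
  have h := apexStarvation_of_C5 s c ℓ m d 8 4 32 5 hc hml hdc hN1 hC5
  rw [ha] at h
  omega

end ApexStarvation

/-! ## §5  Consistency digits with g31's exact mod-`p` values on the fully-live family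

On the fully-live balanced shape `(3⁸,2⁸)` (`Λ = 40·32 = 1280`, `S = 104`, `Bsq = 8`) g31 certified
`e_∞^{1,1} = 4168` and `e_∞^{0,2} = 2264` (`extfloor-toyPresB.json`).  Both laws are violated there, as they must be:
-/

theorem fullyLive_balanced_violates_N1 : ¬ (4 * 1280 ≤ 256 + 8 * 104) := by norm_num

theorem fullyLive_balanced_E11 : 5120 - (8 * 104 + 120) = 4168 := by norm_num

theorem fullyLive_balanced_violates_CAP : ¬ (2264 ≤ 1848) := by norm_num

/-- and the (CAP) floor `168 + 28·104 = 3080 ≤ 6Λ = 7680` is consistent with `Λ = 1280` (fully live) while the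
(N1) cap `Λ ≤ 64 + 208 = 272` is not: on the fully-live family (N1) is the binding law. -/
theorem fullyLive_balanced_digits : 168 + 28 * 104 ≤ 6 * 1280 ∧ ¬ (1280 ≤ 64 + 2 * 104) := by norm_num

end Summit.HodgeConjecture.HodgeConjecture.Cruxes.BlochSeedDiscOne.SeedCheckerSymbolCapacity
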